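import Summits.HodgeConjecture.CorCM.IrreducibleOddWeightsCommutantCentreTranslates
import Summits.HodgeConjecture.CorCM.IrreducibleOddWeightsIndexHellyCMFields
import HarnessLib

/-!
# Density over the commutant, XVIII: ABELIAN GALOIS CLOSURES — on `Hom(L, ℂ)` for `L/ℚ` Galois with ABELIAN group,
# every irreducible constituent `A ≤ ℚ^{Hom(L,ℂ)}` has commutant `= ℚ[Aut ℂ]|_A`, commutative, of degree `δ = dim A`,
# and `dim MT(∏ A_i) − 1 = dim_ℚ ⨆_i D⟨b^i⟩`

COR-CM (cell `pub-hodgecm2`, binder seat `b16` gen 74, count-neutral claim THE CENTRE, file Z5 — CM fields; theorems only,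
no definition, no named fact, no `sorry`).  NEW as stated, hence under `Summits/`.  HONEST FRAMING: file Z4 (`G`-set
dress of the centre / commuting-action results) asks for a COMMUTING action `k·k′·y = k′·k·y` of `Aut(ℂ)` on the
reference set `Y`; for `Y = Hom(L, ℂ)` with `L/ℚ` normal this holds as soon as `Gal(L/ℚ)` is commutative (gen 59
`smul_comm_of_comap_restrictHom`: `Aut(ℂ)` acts through the restriction `Aut(ℂ) ↠ Gal(L/ℚ)`).  So for products of CM
abelian varieties whose CM fields lie in an ABELIAN Galois CM field `L` (cyclotomic fields, …), with type vectors
assembled from one irreducible constituent `A ≤ ℚ^{Hom(L,ℂ)}`: the commutant of `A` is a field of degree `dim A`, equal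
to the image of `ℚ[Aut ℂ]` on `A`, and the Mumford–Tate dimensions are plain `ℚ`-dimensions of D-spans.  Nothing about
Hodge classes is asserted; `HC_CM` is neither used nor asserted.

* `smul_smul_comm_of_gal_comm` (abelian `Gal(L/ℚ)` ⟹ commuting action of `Aut(ℂ)` on `Hom(L, ℂ)`),
  **`finrank_map_applyₗ_eq_finrank_of_gal_comm`** (`δ = dim A`), **`commutant_restrict_eq_span_translates_of_gal_comm`**
  (`𝒟|_A = ℚ[Aut ℂ]|_A`), `commutant_apply_comm_of_gal_comm`, `map_applyₗ_eq_of_gal_comm` (`D·a₀ = A`),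
  **`cmTypeRank_eq_finrank_iSup_add_one_of_gal_comm`** (`dim MT(A_Φ) − 1 = dim_ℚ D⟨b⟩`),
  **`cmFamilyRank_eq_finrank_iSup_add_one_of_gal_comm`** (`dim MT(∏_i A_i) − 1 = dim_ℚ ⨆_i D⟨b^i⟩`).

## References

* [Serre1977] J.-P. Serre, *Linear Representations of Finite Groups*, GTM 42, §3.1, §12.1.
* [Shimura1998] G. Shimura, *Abelian Varieties with Complex Multiplication and Modular Functions*, §8.1.
* [Deligne1982HodgeCycles] P. Deligne, *Hodge cycles on abelian varieties*, LNM 900 (1982), I.3.4, I Ex. 3.7.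
-/

set_option autoImplicit false

noncomputable section

open scoped BigOperators Classical

namespace Summit.HodgeConjecture.CorCM

open CategoryTheory CategoryTheory.Limits NumberField Module IntermediateField
open Literature.NumberTheory.ComplexMultiplication
open Literature.AlgebraicGeometry.Motives (AbelianVariety CMType)
open Literature.AlgebraicGeometry.Motives.AbelianVariety
open Literature.AlgebraicGeometry.HodgeTheory
open Literature.AlgebraicGeometry.ComplexMultiplication (IsCMTypeRealisation)
open Literature.AlgebraicGeometry.Pohlmann1968

variable {I : Type} [Fintype I] {K : I → Type} [∀ i, Field (K i)] [∀ i, NumberField (K i)] [∀ i, IsCMField (K i)]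
  {L : Type} [Field L] [NumberField L] [Normal ℚ L]

/-- **ABELIAN `Gal(L/ℚ)` ⟹ `Aut(ℂ)` ACTS ON `Hom(L, ℂ)` THROUGH COMMUTING PERMUTATIONS** (`L/ℚ` normal; gen 59's
restriction `Aut(ℂ) ↠ Gal(L/ℚ)`). [cite: Shimura1998, §8.1] [cite: Serre1977, §3.1] -/
theorem smul_smul_comm_of_gal_comm (hG : ∀ a b : L ≃ₐ[ℚ] L, a * b = b * a) (τ τ' : ℂ ≃+* ℂ) (s : L →+* ℂ) :
    τ • τ' • s = τ' • τ • s := by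
  obtain ⟨ι⟩ : Nonempty (L →+* ℂ) := inferInstance
  obtain ⟨r, hr, -⟩ := exists_restrictHom ι
  exact smul_comm_of_comap_restrictHom (I := Unit) (K := fun _ => L) ι (fun _ => RingHom.id L) hr ⊤
    (fun a _ b _ => hG a b) τ (Subgroup.mem_comap.2 (Subgroup.mem_top _)) τ'
    (Subgroup.mem_comap.2 (Subgroup.mem_top _)) () s

/-- **`δ = dim A` ON AN ABELIAN GALOIS FIELD**: every `Aut(ℂ)`-stable irreducible `A ≤ ℚ^{Hom(L,ℂ)}` (`Gal(L/ℚ)` abelian)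
has commutant of degree `dim A` (`0 ≠ a₀ ∈ A`; file Z4). [cite: Serre1977, §3.1 and §12.1] -/
theorem finrank_map_applyₗ_eq_finrank_of_gal_comm (hG : ∀ a b : L ≃ₐ[ℚ] L, a * b = b * a)
    {A : Submodule ℚ ((L →+* ℂ) → ℚ)} {𝒟 : Submodule ℚ (((L →+* ℂ) → ℚ) →ₗ[ℚ] ((L →+* ℂ) → ℚ))}
    (h𝒟 : ∀ T : ((L →+* ℂ) → ℚ) →ₗ[ℚ] ((L →+* ℂ) → ℚ), T ∈ 𝒟 ↔ (∀ a ∈ A, T a ∈ A) ∧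
      ∀ (k : ℂ ≃+* ℂ) (a : (L →+* ℂ) → ℚ), a ∈ A → T (fun y => a (k • y)) = fun y => T a (k • y))
    (hAst : ∀ (k : ℂ ≃+* ℂ) (a : (L →+* ℂ) → ℚ), a ∈ A → (fun y => a (k • y)) ∈ A)
    (hAirr : ∀ W : Submodule ℚ ((L →+* ℂ) → ℚ), W ≤ A → W ≠ ⊥ →
      (∀ (k : ℂ ≃+* ℂ) (f : (L →+* ℂ) → ℚ), f ∈ W → (fun y => f (k • y)) ∈ W) → W = A)
    {a₀ : (L →+* ℂ) → ℚ} (ha₀ : a₀ ∈ A) (h0 : a₀ ≠ 0) :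
    Module.finrank ℚ ↥(𝒟.map (LinearMap.applyₗ a₀)) = Module.finrank ℚ A :=
  IrrOdd.finrank_map_applyₗ_eq_finrank_of_comm_translates (smul_smul_comm_of_gal_comm hG) h𝒟 hAst hAirr ha₀ h0

/-- **THE COMMUTANT IS THE IMAGE OF `ℚ[Aut ℂ]` ON `A`** (`Gal(L/ℚ)` abelian, `A ≠ 0` stable irreducible in `ℚ^{Hom(L,ℂ)}`):
`𝒟|_A = span{f ↦ f(k·)}|_A`. [cite: Serre1977, §3.1] -/
theorem commutant_restrict_eq_span_translates_of_gal_comm (hG : ∀ a b : L ≃ₐ[ℚ] L, a * b = b * a)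
    {A : Submodule ℚ ((L →+* ℂ) → ℚ)} {𝒟 : Submodule ℚ (((L →+* ℂ) → ℚ) →ₗ[ℚ] ((L →+* ℂ) → ℚ))}
    (h𝒟 : ∀ T : ((L →+* ℂ) → ℚ) →ₗ[ℚ] ((L →+* ℂ) → ℚ), T ∈ 𝒟 ↔ (∀ a ∈ A, T a ∈ A) ∧
      ∀ (k : ℂ ≃+* ℂ) (a : (L →+* ℂ) → ℚ), a ∈ A → T (fun y => a (k • y)) = fun y => T a (k • y))
    (hAst : ∀ (k : ℂ ≃+* ℂ) (a : (L →+* ℂ) → ℚ), a ∈ A → (fun y => a (k • y)) ∈ A)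
    (hAirr : ∀ W : Submodule ℚ ((L →+* ℂ) → ℚ), W ≤ A → W ≠ ⊥ →
      (∀ (k : ℂ ≃+* ℂ) (f : (L →+* ℂ) → ℚ), f ∈ W → (fun y => f (k • y)) ∈ W) → W = A) (hA : A ≠ ⊥) :
    𝒟.map (LinearMap.domRestrict' A) =
      (Submodule.span ℚ (Set.range fun k : ℂ ≃+* ℂ => LinearMap.funLeft ℚ ℚ (fun y : L →+* ℂ => k • y))).map
        (LinearMap.domRestrict' A) :=
  IrrOdd.commutant_restrict_eq_span_translates_of_comm (smul_smul_comm_of_gal_comm hG) h𝒟 hAst hAirr hA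

/-- **THE COMMUTANT IS COMMUTATIVE** (`Gal(L/ℚ)` abelian). [cite: Serre1977, §3.1] -/
theorem commutant_apply_comm_of_gal_comm (hG : ∀ a b : L ≃ₐ[ℚ] L, a * b = b * a)
    {A : Submodule ℚ ((L →+* ℂ) → ℚ)} {𝒟 : Submodule ℚ (((L →+* ℂ) → ℚ) →ₗ[ℚ] ((L →+* ℂ) → ℚ))}
    (h𝒟 : ∀ T : ((L →+* ℂ) → ℚ) →ₗ[ℚ] ((L →+* ℂ) → ℚ), T ∈ 𝒟 ↔ (∀ a ∈ A, T a ∈ A) ∧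
      ∀ (k : ℂ ≃+* ℂ) (a : (L →+* ℂ) → ℚ), a ∈ A → T (fun y => a (k • y)) = fun y => T a (k • y))
    (hAst : ∀ (k : ℂ ≃+* ℂ) (a : (L →+* ℂ) → ℚ), a ∈ A → (fun y => a (k • y)) ∈ A)
    (hAirr : ∀ W : Submodule ℚ ((L →+* ℂ) → ℚ), W ≤ A → W ≠ ⊥ →
      (∀ (k : ℂ ≃+* ℂ) (f : (L →+* ℂ) → ℚ), f ∈ W → (fun y => f (k • y)) ∈ W) → W = A)
    {T T' : ((L →+* ℂ) → ℚ) →ₗ[ℚ] ((L →+* ℂ) → ℚ)} (hT : T ∈ 𝒟) (hT' : T' ∈ 𝒟) {a : (L →+* ℂ) → ℚ}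
    (ha : a ∈ A) : T (T' a) = T' (T a) :=
  IrrOdd.commutant_apply_comm_of_comm_translates (smul_smul_comm_of_gal_comm hG) h𝒟 hAst hAirr hT hT' ha

/-- **`D·a₀ = A`** (`Gal(L/ℚ)` abelian, `0 ≠ a₀ ∈ A`): the commutant is transitive on `A ∖ 0`. [cite: Serre1977, §3.1] -/
theorem map_applyₗ_eq_of_gal_comm (hG : ∀ a b : L ≃ₐ[ℚ] L, a * b = b * a)
    {A : Submodule ℚ ((L →+* ℂ) → ℚ)} {𝒟 : Submodule ℚ (((L →+* ℂ) → ℚ) →ₗ[ℚ] ((L →+* ℂ) → ℚ))}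
    (h𝒟 : ∀ T : ((L →+* ℂ) → ℚ) →ₗ[ℚ] ((L →+* ℂ) → ℚ), T ∈ 𝒟 ↔ (∀ a ∈ A, T a ∈ A) ∧
      ∀ (k : ℂ ≃+* ℂ) (a : (L →+* ℂ) → ℚ), a ∈ A → T (fun y => a (k • y)) = fun y => T a (k • y))
    (hAst : ∀ (k : ℂ ≃+* ℂ) (a : (L →+* ℂ) → ℚ), a ∈ A → (fun y => a (k • y)) ∈ A)
    (hAirr : ∀ W : Submodule ℚ ((L →+* ℂ) → ℚ), W ≤ A → W ≠ ⊥ →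
      (∀ (k : ℂ ≃+* ℂ) (f : (L →+* ℂ) → ℚ), f ∈ W → (fun y => f (k • y)) ∈ W) → W = A)
    {a₀ : (L →+* ℂ) → ℚ} (ha₀ : a₀ ∈ A) (h0 : a₀ ≠ 0) :
    𝒟.map (LinearMap.applyₗ a₀) = A :=
  IrrOdd.map_applyₗ_eq_of_comm_translates (smul_smul_comm_of_gal_comm hG) h𝒟 hAst hAirr ha₀ h0

omit [Fintype I] in
/-- **`cmTypeRank Φ = dim D⟨b⟩ + 1` OVER AN ABELIAN GALOIS CLOSURE**: for a CM type `Φ` of `K_{i₀}` whose type vector is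
assembled from an irreducible constituent `A ≤ ℚ^{Hom(L,ℂ)}` (`Gal(L/ℚ)` abelian), `dim MT(A_Φ) − 1 = dim_ℚ D⟨b⟩`.
[cite: Serre1977, §3.1] [cite: Deligne1982HodgeCycles, I.3.4] -/
theorem cmTypeRank_eq_finrank_iSup_add_one_of_gal_comm (hG : ∀ a b : L ≃ₐ[ℚ] L, a * b = b * a)
    (Φ : ∀ i, CMType (K i)) (i₀ : I)
    {A : Submodule ℚ ((L →+* ℂ) → ℚ)} {𝒟 : Submodule ℚ (((L →+* ℂ) → ℚ) →ₗ[ℚ] ((L →+* ℂ) → ℚ))}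
    (h𝒟 : ∀ T : ((L →+* ℂ) → ℚ) →ₗ[ℚ] ((L →+* ℂ) → ℚ), T ∈ 𝒟 ↔ (∀ a ∈ A, T a ∈ A) ∧
      ∀ (k : ℂ ≃+* ℂ) (a : (L →+* ℂ) → ℚ), a ∈ A → T (fun y => a (k • y)) = fun y => T a (k • y))
    (hAst : ∀ (k : ℂ ≃+* ℂ) (a : (L →+* ℂ) → ℚ), a ∈ A → (fun y => a (k • y)) ∈ A)
    (hAirr : ∀ W : Submodule ℚ ((L →+* ℂ) → ℚ), W ≤ A → W ≠ ⊥ →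
      (∀ (k : ℂ ≃+* ℂ) (f : (L →+* ℂ) → ℚ), f ∈ W → (fun y => f (k • y)) ∈ W) → W = A)
    (hA0 : A ≠ ⊥) {J₀ : Type} [Fintype J₀] (ι₀ : J₀ → (((L →+* ℂ) → ℚ) →ₗ[ℚ] ((K i₀ →+* ℂ) → ℚ)))
    (hι₀eq : ∀ (j : J₀) (k : ℂ ≃+* ℂ) (a : (L →+* ℂ) → ℚ), a ∈ A →
      ι₀ j (fun y => a (k • y)) = fun y => ι₀ j a (k • y))
    (hind₀ : ∀ f : J₀ → ((L →+* ℂ) → ℚ), (∀ j, f j ∈ A) → ∑ j, ι₀ j (f j) = 0 → ∀ j, f j = 0)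
    {b₀ : J₀ → ((L →+* ℂ) → ℚ)} (hb₀ : ∀ j, b₀ j ∈ A) (hu₀ : antiVec (Φ i₀).1 (1 : ℂ ≃+* ℂ) = ∑ j, ι₀ j (b₀ j)) :
    cmTypeRank (Φ i₀) = Module.finrank ℚ ↥(⨆ j, 𝒟.map (LinearMap.applyₗ (b₀ j))) + 1 :=
  cmTypeRank_eq_finrank_iSup_add_one_of_comm (smul_smul_comm_of_gal_comm hG) Φ i₀ h𝒟 hAst hAirr hA0 ι₀ hι₀eq hind₀
    hb₀ hu₀

/-- **`cmFamilyRank Φ = dim(⨆_i D⟨b^i⟩) + 1` OVER AN ABELIAN GALOIS CLOSURE**: for CM types `Φ_i` of `K_i` whose type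
vectors are ALL assembled from one irreducible constituent `A ≤ ℚ^{Hom(L,ℂ)}` (`Gal(L/ℚ)` abelian),
`dim MT(∏_i A_i) − 1 = dim_ℚ ⨆_i D⟨b^i⟩`. [cite: Serre1977, §3.1] [cite: Deligne1982HodgeCycles, I Ex. 3.7 (c)] -/
theorem cmFamilyRank_eq_finrank_iSup_add_one_of_gal_comm [Nonempty I] (hG : ∀ a b : L ≃ₐ[ℚ] L, a * b = b * a)
    (Φ : ∀ i, CMType (K i))
    {A : Submodule ℚ ((L →+* ℂ) → ℚ)} {𝒟 : Submodule ℚ (((L →+* ℂ) → ℚ) →ₗ[ℚ] ((L →+* ℂ) → ℚ))}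
    (h𝒟 : ∀ T : ((L →+* ℂ) → ℚ) →ₗ[ℚ] ((L →+* ℂ) → ℚ), T ∈ 𝒟 ↔ (∀ a ∈ A, T a ∈ A) ∧
      ∀ (k : ℂ ≃+* ℂ) (a : (L →+* ℂ) → ℚ), a ∈ A → T (fun y => a (k • y)) = fun y => T a (k • y))
    (hAst : ∀ (k : ℂ ≃+* ℂ) (a : (L →+* ℂ) → ℚ), a ∈ A → (fun y => a (k • y)) ∈ A)
    (hAirr : ∀ W : Submodule ℚ ((L →+* ℂ) → ℚ), W ≤ A → W ≠ ⊥ →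
      (∀ (k : ℂ ≃+* ℂ) (f : (L →+* ℂ) → ℚ), f ∈ W → (fun y => f (k • y)) ∈ W) → W = A)
    (hA0 : A ≠ ⊥) {J : I → Type} [∀ i, Fintype (J i)] (ι : ∀ i, J i → (((L →+* ℂ) → ℚ) →ₗ[ℚ] ((K i →+* ℂ) → ℚ)))
    (hιeq : ∀ i (j : J i) (k : ℂ ≃+* ℂ) (a : (L →+* ℂ) → ℚ), a ∈ A →
      ι i j (fun y => a (k • y)) = fun y => ι i j a (k • y))
    (hind : ∀ i (f : J i → ((L →+* ℂ) → ℚ)), (∀ j, f j ∈ A) → ∑ j, ι i j (f j) = 0 → ∀ j, f j = 0)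
    {b : ∀ i, J i → ((L →+* ℂ) → ℚ)} (hb : ∀ i j, b i j ∈ A)
    (hu : ∀ i, antiVec (Φ i).1 (1 : ℂ ≃+* ℂ) = ∑ j, ι i j (b i j)) :
    CMAlgebra.cmFamilyRank Φ = Module.finrank ℚ ↥(⨆ i, ⨆ j, 𝒟.map (LinearMap.applyₗ (b i j))) + 1 :=
  cmFamilyRank_eq_finrank_iSup_add_one_of_comm (smul_smul_comm_of_gal_comm hG) Φ h𝒟 hAst hAirr hA0 ι hιeq hind hb hu

end Summit.HodgeConjecture.CorCM

end
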